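import Summits.BirchSwinnertonDyer.BirchSwinnertonDyer.Theorems.KimAtThreeShallowEqDeepUnlockedTower
import Summits.BirchSwinnertonDyer.BirchSwinnertonDyer.Theorems.KimAtThreeShallowEqDeepOffStratumAdditiveDefectOfPort
import HarnessLib

/-!
# Route `KimAtThreeKolyvagin` (W2), cruxes `ShallowEqDeepOffKatoStratum` (19599) / `ShallowEqDeepAtTorsionFree`
# (19077): ALL FOUR row conclusions of the route — UPPER (19562/19076), the residual (R), SHALLOW = DEEP
# (19599/19077), LOWER (19679/19075) and the LEAF row — on EVERY `3`-adic-tower row from PUB + ONE UNLOCKED port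

Cell `bsd-addord`, seat `bsd-addord-w2-c4` (gen 7, owner of item 19599); `--supports` 19599.
HONEST FRAMING. TOOL theorems only (no definition, no named fact, no `sorry`); nothing asserted about any curve,
nothing booked; 19599 / 19562 / 19679 / 19077 / 19560 stay OPEN; BSD is not proved by any of this.  CONDITIONAL,
by hypothesis, on: [S24] Thm. 4.4 (1)(2) `hS24`/`hS24₂` (PUB), GZK `hGZK` (PUB), Poitou–Tate `hPT` (PUB, by name),
and ONE displayed port `hPort` at the row — the UNLOCKED shared-generator Kato–Kurihara closure at the datum `D`:
for all depths `k ≤ k′`, all `τ`-data canonical for THE SAME generator family `η`, every pinned reduction `red`,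
the bare two-depth witness clauses `KimAtThreeKolyvaginDefs.KatoKuriharaWitnessAtTwoExp W · 0 e · v₃ D …` + (COMP)
(value law `3^e · Λ(loc κ_d) = u · 3^0 · δ̃_{n(d)}`, SOME `e`).  FLAG `K22-Thm3.13-PORT@3`: NOT in print at `3`
(Kim, AJM 148 Thm. 3.13 is `p ≥ 5`; Kim–Pollack arXiv:2505.09121 §4.2 states it at `p ≥ 3` up to a uniform
constant, PRE); it is the COMMON UNLOCKED FORM of the cell's three typed ports — crux 19560's PORT″ on the Kato
stratum (`KimAtThreeKolyvaginDefs.katoKuriharaPortThreeAtWith₂TwoExp_zero_of_portThreeAtWith₂`, `e = 0`), acc6's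
PORT₂ on the additive-defect rows (`e = v₃(c₃) + v₃(c_D)` in print), and the non-additive dictionary of definition
item `defn-KatoKuriharaDictionaryThreeNonAddAt` (good / multiplicative `3`: the same clauses, local lattice Kim AJM
Lemma 3.3 / 3.8 instead of Lemma 3.9) — each of which unlocks to `hPort` BY ITS OWN ROW.

WHAT.  At a row {`W/ℚ` globally minimal, the `3`-adic tower onto, a parametrisation datum `D` (at the conductor
for (R)), `3`-integral plus symbols, `ord(δ̃) = 0`} — NO hypothesis on the reduction type at `3`, on `c₃`, on the
Manin constant, NO period transfer, and `E(ℚ₃)[3] = 0` only through the `t`-slot `0` of the value law: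
* `portE_of_portUnlocked` — the unlocked port gives acc1's single-depth port (n1011's `KatoKuriharaWitnessAt`,
  exponent `0`, Kato's families scaled by `3^e`: acc6's `katoKuriharaWitnessAt_smul_of_witnessAtTwoExp`);
* `upper_row_of_portUnlocked` — `∃ d, ∂^{(∞)}_deep = d ∧ ord₃ #Ш(3) + d ≤ ∂⁽⁰⁾` (acc1's
  `deepUpper_conclusion_of_port_e`): the row of cruxes 19076 / 19562;
* `residual_row_of_portUnlocked` — `∂⁽⁰⁾ ≤ ord₃ #Ш(3) + ∂^{(∞)}` (ALL levels): w2-c4 g6's residual (R) at the row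
  (`KimAtThreeShallowEqDeepUnlockedTower.kuriharaPartial_zero_le_sha_add_partialInfty_of_portUnlocked`);
* `shallowEqDeep_row_of_portUnlocked` — `∂^{(∞)}_deep ≤ ∂^{(∞)}`: the row of cruxes 19077 / 19599 (socket p449980);
* `lower_row_of_portUnlocked` — `∃ d, ∂^{(∞)}_deep = d ∧ ∂⁽⁰⁾ ≤ ord₃ #Ш(3) + d`: the row of 19075 / 19679;
* `leaf_row_of_portUnlocked` — `∃ d, ∂^{(∞)} = d ∧ ∂⁽⁰⁾ = ord₃ #Ш(3) + d`: the row of the LEAF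
  `N11.KimAtThreeRankZeroPUB` (Kim's clause (6) at `3` for the row).
So on every `E(ℚ₃)[3] = 0` tower row the whole W2 leaf is {PUB} + {ONE unlocked Kato–Kurihara port}; TamDiv∞,
(DD), the twin hypotheses and the Kato-stratum binders are not inputs.
References: [Kim2022StructureSelmer] Thm. 1.9 (6), Thm. 3.13, Lemma 3.3, 3.8, 3.9; [Kim2025RefinedTNC] Thm 1.1/1.2,
§4.2, §8.1.2; [Sakamoto2024] Thm. 4.4; [MazurRubin2004] Thm. 4.4.1, 5.2.12; [Kato2004Asterisque] Thm. 12.5 (1);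
[MilneADT2006] I Thm. 4.10.
-/

set_option autoImplicit false
-- the Theorems namespace of a single-conjunct summit repeats the summit name by design (D-0017)
set_option linter.dupNamespace false

noncomputable section

open scoped Classical NumberField ContRepresentation
open Function Field NumberField IsDedekindDomain IsDedekindDomain.HeightOneSpectrum WeierstrassCurve
  CongruenceSubgroup
  Literature.NumberTheory.EllipticCurves Literature.NumberTheory.EllipticCurves.ModularForms
  Literature.NumberTheory.EllipticCurves.Rank1Residual
  Literature.NumberTheory.GaloisRepresentations
  Literature.NumberTheory.GaloisRepresentations.DiscreteGaloisModule Literature.NumberTheory.GaloisCohomology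
  Rat.HeightOneSpectrum
  Summit.BirchSwinnertonDyer.Rank1Residual.GaloisImage
  Summit.BirchSwinnertonDyer.Rank1Residual.GaloisImage.Assembly
  Summit.BirchSwinnertonDyer.Rank1Residual.X4

namespace Summit.BirchSwinnertonDyer.BirchSwinnertonDyer.Theorems.KimAtThreeShallowEqDeepPortRows

open Summit.BirchSwinnertonDyer.BirchSwinnertonDyer.Theorems.KimAtThreeKolyvaginDefs
  Summit.BirchSwinnertonDyer.BirchSwinnertonDyer.Theorems.KimAtThreeShallowEqDeepUnlockedTower
  Summit.BirchSwinnertonDyer.BirchSwinnertonDyer.Theorems.KimAtThreeShallowEqDeepOffStratumAdditiveDefect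
  Summit.BirchSwinnertonDyer.BirchSwinnertonDyer.Theorems.KimAtThreeDeepUpperOffStratumPortE
  Summit.BirchSwinnertonDyer.BirchSwinnertonDyer.Theorems.KimAtThreeShallowEqDeepOffStratumSockets
  Summit.BirchSwinnertonDyer.BirchSwinnertonDyer.Theorems.KimAtThreeKolyvaginUnitLevelOneRungs
  Summit.BirchSwinnertonDyer.BirchSwinnertonDyer.Theorems.KimAtThreeKolyvaginCertificateDictionary
  Summit.BirchSwinnertonDyer.BirchSwinnertonDyer.Theorems.KimAtThreeDeepLowerKatoStratumOfFacts

/-! ### §1 The unlocked port feeds acc1's single-depth port -/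

/-- **The UNLOCKED two-depth port gives acc1's single-depth port** (n1011's one-exponent witness clauses
`KatoKuriharaWitnessAt W k 0 Dk v₃ D …` at every canonical `τ`-datum for `η`): the dictionary at `(k, k)` with
the pinned reduction of `exists_torsionReduction_three`, Kato's families scaled by `3^e`
(`katoKuriharaWitnessAt_smul_of_witnessAtTwoExp`).  Twin of acc6's `portE_zero_of_portTwoExp` with no `Addv`,
no `E(ℚ₃)[3] = 0` binder. [cite: Kim2022StructureSelmer, Thm. 3.13 (arXiv p. 17)] [cite: Kato2004Asterisque, Thm. 12.5 (1)] -/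
theorem portE_of_portUnlocked
    (W : WeierstrassCurve ℚ) [W.IsElliptic] [W.IsGloballyMinimal]
    {N : ℕ} [NeZero N] (D : ModularParametrizationData W N) (e : ℕ) (v₃ : HeightOneSpectrum (𝓞 ℚ))
    (η : (q : HeightOneSpectrum (𝓞 ℚ)) → (ZMod (Ideal.absNorm q.asIdeal))ˣ)
    (hPort : ∀ (k k' : ℕ) (Dk : KolyvaginDatum (W.torsionGaloisModule (((3 : ℕ) : ℤ) ^ k * ((3 : ℕ) : ℤ))))
      (Dk' : KolyvaginDatum (W.torsionGaloisModule (((3 : ℕ) : ℤ) ^ k' * ((3 : ℕ) : ℤ))))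
      (red : (W.torsionGaloisModule (((3 : ℕ) : ℤ) ^ k' * ((3 : ℕ) : ℤ))).toContRepresentation →ⁱL
        (W.torsionGaloisModule (((3 : ℕ) : ℤ) ^ k * ((3 : ℕ) : ℤ))).toContRepresentation),
      Dk.IsCanonicalTauDatumThreeAtWith W k k η → Dk'.IsCanonicalTauDatumThreeAtWith W k' k' η → k ≤ k' →
      (∀ x : geomTorsion W (((3 : ℕ) : ℤ) ^ k' * ((3 : ℕ) : ℤ)),
        ((red x : geomTorsion W (((3 : ℕ) : ℤ) ^ k * ((3 : ℕ) : ℤ))) : geomPoints W) =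
          (((3 : ℕ) : ℤ) ^ (k' - k)) • (x : geomPoints W)) →
      ∃ κ Λ κ' κu Λu κu',
        KatoKuriharaWitnessAtTwoExp W k 0 e Dk v₃ D κ Λ κ' ∧
        KatoKuriharaWitnessAtTwoExp W k' 0 e Dk' v₃ D κu Λu κu' ∧
        ∀ d, Dk'.IsLevel d → Dk.IsLevel d →
          galoisCohomology.map red 1 (κu d) = κ d ∧ galoisCohomology.map red 1 (κu' d) = κ' d) :
    ∀ (k : ℕ) (Dk : KolyvaginDatum (W.torsionGaloisModule (((3 : ℕ) : ℤ) ^ k * ((3 : ℕ) : ℤ)))),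
      Dk.IsCanonicalTauDatumThreeAtWith W k k η →
      ∃ (κ : Finset (HeightOneSpectrum (𝓞 ℚ)) →
            galoisCohomology (W.torsionGaloisModule (((3 : ℕ) : ℤ) ^ k * ((3 : ℕ) : ℤ))) 1)
        (Λ : galoisCohomology ((W.torsionGaloisModule (((3 : ℕ) : ℤ) ^ k * ((3 : ℕ) : ℤ))).toLocal
            (Sum.inr v₃)) 1 →+ ZMod (3 ^ (k + 1)))
        (κ' : Finset (HeightOneSpectrum (𝓞 ℚ)) →
            galoisCohomology (W.torsionGaloisModule (((3 : ℕ) : ℤ) ^ k * ((3 : ℕ) : ℤ))) 1),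
        KatoKuriharaWitnessAt W k 0 Dk v₃ D κ Λ κ' := by
  intro k Dk hDk
  obtain ⟨red, hred⟩ := exists_torsionReduction_three W k k
  obtain ⟨κ, Λ, κ', -, -, -, hW, -, -⟩ := hPort k k Dk Dk red hDk hDk le_rfl hred
  exact ⟨_, Λ, _, katoKuriharaWitnessAt_smul_of_witnessAtTwoExp W k 0 e Dk v₃ D κ Λ κ' hW⟩

/-! ### §2 The four rows of the route at ONE row from PUB + the unlocked port -/


/-- **UPPER row (cruxes 19076 / 19562) at ANY tower row from PUB + the unlocked port**: acc1's
`KimAtThreeDeepUpperOffStratumPortE.deepUpper_conclusion_of_port_e` (the END-OF-PORTS road of w2-c3/w2-c4 with a free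
dictionary exponent) fed by `portE_of_portUnlocked`; needs `L(E,1) ≠ 0` (`hL`) rather than `ord(δ̃) = 0`.
[cite: Kim2025RefinedTNC, Thm 1.1, §5] [cite: Kim2022StructureSelmer, Thm. 1.9 (6) and Thm. 3.13]
[cite: MazurRubin2004, Thm. 4.4.1] [cite: Sakamoto2024, Thm. 4.4 (1)(2) (p. 926)] [cite: MilneADT2006, Ch. I, Thm. 4.10] -/
theorem upper_row_of_portUnlocked_of_L
    (hS24 : Sakamoto2024.kolyvaginSystems_freeRankOne_zmod_three_pow)
    (hS24₂ : Sakamoto2024.kolyvaginSystems_idealOfBasis_eq_fittingIdeal_zmod_three_pow)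
    (hGZK : rank_eq_analyticRank_of_analyticRank_le_one) (hPT : poitouTate_selmerStructure_duality ℚ)
    (W : WeierstrassCurve ℚ) [W.IsElliptic] [W.IsGloballyMinimal]
    (htower : ∀ m : ℕ, W.HasSurjectiveModNGaloisRep (3 ^ m : ℕ))
    {N : ℕ} [NeZero N] (D : ModularParametrizationData W N) (e : ℕ)
    (hint : ∀ r : ℚ, ratPlusSymbol D.f r ≠ 0 → 0 ≤ padicValRat 3 (ratPlusSymbol D.f r))
    (v₃ : HeightOneSpectrum (𝓞 ℚ)) (hv₃ : ((3 : ℕ) : 𝓞 ℚ) ∈ v₃.asIdeal)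
    (η : (q : HeightOneSpectrum (𝓞 ℚ)) → (ZMod (Ideal.absNorm q.asIdeal))ˣ)
    (hη : ∀ q : HeightOneSpectrum (𝓞 ℚ), Subgroup.zpowers (η q) = ⊤)
    (hPort : ∀ (k k' : ℕ) (Dk : KolyvaginDatum (W.torsionGaloisModule (((3 : ℕ) : ℤ) ^ k * ((3 : ℕ) : ℤ))))
      (Dk' : KolyvaginDatum (W.torsionGaloisModule (((3 : ℕ) : ℤ) ^ k' * ((3 : ℕ) : ℤ))))
      (red : (W.torsionGaloisModule (((3 : ℕ) : ℤ) ^ k' * ((3 : ℕ) : ℤ))).toContRepresentation →ⁱL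
        (W.torsionGaloisModule (((3 : ℕ) : ℤ) ^ k * ((3 : ℕ) : ℤ))).toContRepresentation),
      Dk.IsCanonicalTauDatumThreeAtWith W k k η → Dk'.IsCanonicalTauDatumThreeAtWith W k' k' η → k ≤ k' →
      (∀ x : geomTorsion W (((3 : ℕ) : ℤ) ^ k' * ((3 : ℕ) : ℤ)),
        ((red x : geomTorsion W (((3 : ℕ) : ℤ) ^ k * ((3 : ℕ) : ℤ))) : geomPoints W) =
          (((3 : ℕ) : ℤ) ^ (k' - k)) • (x : geomPoints W)) →
      ∃ κ Λ κ' κu Λu κu',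
        KatoKuriharaWitnessAtTwoExp W k 0 e Dk v₃ D κ Λ κ' ∧
        KatoKuriharaWitnessAtTwoExp W k' 0 e Dk' v₃ D κu Λu κu' ∧
        ∀ d, Dk'.IsLevel d → Dk.IsLevel d →
          galoisCohomology.map red 1 (κu d) = κ d ∧ galoisCohomology.map red 1 (κu' d) = κ' d)
    (hL : W.entireLFunction 1 ≠ 0) :
    ∃ dd : ℕ, kuriharaPartialDeepInfty W 3 D.f = dd ∧
      ((padicValNat 3 (Nat.card (AddCommGroup.primaryComponent W.sha 3)) + dd : ℕ) : ℕ∞) ≤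
        kuriharaPartial W 3 D.f 0 := by
  obtain ⟨inv, hperf, hsum, -, hcompl⟩ := hPT 3
  obtain ⟨inv', hperf', hsum', hcompl', hinj'⟩ := exists_localInvariants_three_pow_of_poitouTate hPT
  exact deepUpper_conclusion_of_port_e hS24 hS24₂ hGZK W htower hL D hint inv hperf hsum hcompl inv' hperf' hsum'
    hcompl' hinj' v₃ hv₃ η hη 0 (portE_of_portUnlocked W D e v₃ η hPort)

/-- **UPPER row (cruxes 19076 / 19562) at ANY tower row with `ord(δ̃) = 0` from PUB + the unlocked port.**
[cite: Kim2025RefinedTNC, Thm 1.1, §5] [cite: Kim2022StructureSelmer, Thm. 1.9 (6) and Thm. 3.13]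
[cite: Sakamoto2024, Thm. 4.4 (1)(2) (p. 926)] -/
theorem upper_row_of_portUnlocked
    (hS24 : Sakamoto2024.kolyvaginSystems_freeRankOne_zmod_three_pow)
    (hS24₂ : Sakamoto2024.kolyvaginSystems_idealOfBasis_eq_fittingIdeal_zmod_three_pow)
    (hGZK : rank_eq_analyticRank_of_analyticRank_le_one) (hPT : poitouTate_selmerStructure_duality ℚ)
    (W : WeierstrassCurve ℚ) [W.IsElliptic] [W.IsGloballyMinimal]
    (htower : ∀ m : ℕ, W.HasSurjectiveModNGaloisRep (3 ^ m : ℕ))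
    {N : ℕ} [NeZero N] (D : ModularParametrizationData W N) (e : ℕ)
    (hint : ∀ r : ℚ, ratPlusSymbol D.f r ≠ 0 → 0 ≤ padicValRat 3 (ratPlusSymbol D.f r))
    (hord : kuriharaVanishingOrder W 3 D.f = 0)
    (v₃ : HeightOneSpectrum (𝓞 ℚ)) (hv₃ : ((3 : ℕ) : 𝓞 ℚ) ∈ v₃.asIdeal)
    (η : (q : HeightOneSpectrum (𝓞 ℚ)) → (ZMod (Ideal.absNorm q.asIdeal))ˣ)
    (hη : ∀ q : HeightOneSpectrum (𝓞 ℚ), Subgroup.zpowers (η q) = ⊤)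
    (hPort : ∀ (k k' : ℕ) (Dk : KolyvaginDatum (W.torsionGaloisModule (((3 : ℕ) : ℤ) ^ k * ((3 : ℕ) : ℤ))))
      (Dk' : KolyvaginDatum (W.torsionGaloisModule (((3 : ℕ) : ℤ) ^ k' * ((3 : ℕ) : ℤ))))
      (red : (W.torsionGaloisModule (((3 : ℕ) : ℤ) ^ k' * ((3 : ℕ) : ℤ))).toContRepresentation →ⁱL
        (W.torsionGaloisModule (((3 : ℕ) : ℤ) ^ k * ((3 : ℕ) : ℤ))).toContRepresentation),
      Dk.IsCanonicalTauDatumThreeAtWith W k k η → Dk'.IsCanonicalTauDatumThreeAtWith W k' k' η → k ≤ k' →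
      (∀ x : geomTorsion W (((3 : ℕ) : ℤ) ^ k' * ((3 : ℕ) : ℤ)),
        ((red x : geomTorsion W (((3 : ℕ) : ℤ) ^ k * ((3 : ℕ) : ℤ))) : geomPoints W) =
          (((3 : ℕ) : ℤ) ^ (k' - k)) • (x : geomPoints W)) →
      ∃ κ Λ κ' κu Λu κu',
        KatoKuriharaWitnessAtTwoExp W k 0 e Dk v₃ D κ Λ κ' ∧
        KatoKuriharaWitnessAtTwoExp W k' 0 e Dk' v₃ D κu Λu κu' ∧
        ∀ d, Dk'.IsLevel d → Dk.IsLevel d →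
          galoisCohomology.map red 1 (κu d) = κ d ∧ galoisCohomology.map red 1 (κu' d) = κ' d) :
    ∃ dd : ℕ, kuriharaPartialDeepInfty W 3 D.f = dd ∧
      ((padicValNat 3 (Nat.card (AddCommGroup.primaryComponent W.sha 3)) + dd : ℕ) : ℕ∞) ≤
        kuriharaPartial W 3 D.f 0 :=
  upper_row_of_portUnlocked_of_L hS24 hS24₂ hGZK hPT W htower D e hint v₃ hv₃ η hη hPort
    (D.isNewformOf.entireLFunction_one_ne_zero_of_ratPlusSymbol_zero_ne_zero
      (ratPlusSymbol_zero_ne_zero_of_kuriharaVanishingOrder_eq_zero W 3 D.f hord))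

/-- **The residual (R) at ANY tower row with the datum at the conductor: `∂⁽⁰⁾ ≤ ord₃ #Ш(3) + ∂^{(∞)}`, ALL
levels** (w2-c4 g6 `KimAtThreeShallowEqDeepOffStratumResidual`'s displayed `hR` AT THE ROW) from PUB + the unlocked
port: `KimAtThreeShallowEqDeepUnlockedTower.kuriharaPartial_zero_le_sha_add_partialInfty_of_portUnlocked` with the
Poitou–Tate families supplied by the named fact. [cite: Kim2022StructureSelmer, Thm. 1.9 (6), §1.5.1]
[cite: Kim2025RefinedTNC, Thm 1.1 and §8.1.2] [cite: Sakamoto2024, Thm. 4.4 (p. 926)] [cite: MilneADT2006, Ch. I, Thm. 4.10] -/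
theorem residual_row_of_portUnlocked
    (hS24 : Sakamoto2024.kolyvaginSystems_freeRankOne_zmod_three_pow)
    (hS24₂ : Sakamoto2024.kolyvaginSystems_idealOfBasis_eq_fittingIdeal_zmod_three_pow)
    (hGZK : rank_eq_analyticRank_of_analyticRank_le_one) (hPT : poitouTate_selmerStructure_duality ℚ)
    (W : WeierstrassCurve ℚ) [W.IsElliptic] [W.IsGloballyMinimal]
    (htower : ∀ m : ℕ, W.HasSurjectiveModNGaloisRep (3 ^ m : ℕ))
    {N : ℕ} [NeZero N] (D : ModularParametrizationData W N) (e : ℕ)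
    (hord : kuriharaVanishingOrder W 3 D.f = 0)
    (v₃ : HeightOneSpectrum (𝓞 ℚ)) (hv₃ : ((3 : ℕ) : 𝓞 ℚ) ∈ v₃.asIdeal)
    (η : (q : HeightOneSpectrum (𝓞 ℚ)) → (ZMod (Ideal.absNorm q.asIdeal))ˣ)
    (hη : ∀ q : HeightOneSpectrum (𝓞 ℚ), Subgroup.zpowers (η q) = ⊤)
    (hPort : ∀ (k k' : ℕ) (Dk : KolyvaginDatum (W.torsionGaloisModule (((3 : ℕ) : ℤ) ^ k * ((3 : ℕ) : ℤ))))
      (Dk' : KolyvaginDatum (W.torsionGaloisModule (((3 : ℕ) : ℤ) ^ k' * ((3 : ℕ) : ℤ))))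
      (red : (W.torsionGaloisModule (((3 : ℕ) : ℤ) ^ k' * ((3 : ℕ) : ℤ))).toContRepresentation →ⁱL
        (W.torsionGaloisModule (((3 : ℕ) : ℤ) ^ k * ((3 : ℕ) : ℤ))).toContRepresentation),
      Dk.IsCanonicalTauDatumThreeAtWith W k k η → Dk'.IsCanonicalTauDatumThreeAtWith W k' k' η → k ≤ k' →
      (∀ x : geomTorsion W (((3 : ℕ) : ℤ) ^ k' * ((3 : ℕ) : ℤ)),
        ((red x : geomTorsion W (((3 : ℕ) : ℤ) ^ k * ((3 : ℕ) : ℤ))) : geomPoints W) =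
          (((3 : ℕ) : ℤ) ^ (k' - k)) • (x : geomPoints W)) →
      ∃ κ Λ κ' κu Λu κu',
        KatoKuriharaWitnessAtTwoExp W k 0 e Dk v₃ D κ Λ κ' ∧
        KatoKuriharaWitnessAtTwoExp W k' 0 e Dk' v₃ D κu Λu κu' ∧
        ∀ d, Dk'.IsLevel d → Dk.IsLevel d →
          galoisCohomology.map red 1 (κu d) = κ d ∧ galoisCohomology.map red 1 (κu' d) = κ' d)
    (hN : N = W.conductorNorm ℤ) :
    kuriharaPartial W 3 D.f 0 ≤
      (padicValNat 3 (Nat.card (AddCommGroup.primaryComponent W.sha 3)) : ℕ∞) +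
        kuriharaPartialInfty W 3 D.f := by
  obtain ⟨inv, hperf, hsum, -, hcompl⟩ := hPT 3
  obtain ⟨inv', hperf', hsum', hcompl', hinj'⟩ := exists_localInvariants_three_pow_of_poitouTate hPT
  exact kuriharaPartial_zero_le_sha_add_partialInfty_of_portUnlocked hS24 hS24₂ hGZK W htower hN D e inv hperf
    hsum hcompl inv' hperf' hsum' hcompl' hinj' v₃ hv₃ η hη hPort hord

/-- **SHALLOW = DEEP (cruxes 19077 / 19599) at ANY tower row with the datum at the conductor:
`∂^{(∞)}_deep ≤ ∂^{(∞)}`** from PUB + the unlocked port — the upper row and (R) through w2-c4 g5's socket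
`shallowEqDeep_conclusion_of_upperRow_of_le_add_partialInfty` (`s + d ≤ a ≤ s + ∂`).  No reduction type at `3`,
no `c₃`, no Manin constant, no period transfer, no TamDiv∞, no twin hypothesis.
[cite: Kim2025RefinedTNC, Thm 1.1, Thm 1.2] [cite: Kim2022StructureSelmer, Thm. 1.9 (6), §1.5.1]
[cite: MazurRubin2004, Thm. 5.2.12] [cite: Sakamoto2024, Thm. 4.4 (p. 926)] -/
theorem shallowEqDeep_row_of_portUnlocked
    (hS24 : Sakamoto2024.kolyvaginSystems_freeRankOne_zmod_three_pow)
    (hS24₂ : Sakamoto2024.kolyvaginSystems_idealOfBasis_eq_fittingIdeal_zmod_three_pow)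
    (hGZK : rank_eq_analyticRank_of_analyticRank_le_one) (hPT : poitouTate_selmerStructure_duality ℚ)
    (W : WeierstrassCurve ℚ) [W.IsElliptic] [W.IsGloballyMinimal]
    (htower : ∀ m : ℕ, W.HasSurjectiveModNGaloisRep (3 ^ m : ℕ))
    {N : ℕ} [NeZero N] (D : ModularParametrizationData W N) (e : ℕ)
    (hint : ∀ r : ℚ, ratPlusSymbol D.f r ≠ 0 → 0 ≤ padicValRat 3 (ratPlusSymbol D.f r))
    (hord : kuriharaVanishingOrder W 3 D.f = 0)
    (v₃ : HeightOneSpectrum (𝓞 ℚ)) (hv₃ : ((3 : ℕ) : 𝓞 ℚ) ∈ v₃.asIdeal)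
    (η : (q : HeightOneSpectrum (𝓞 ℚ)) → (ZMod (Ideal.absNorm q.asIdeal))ˣ)
    (hη : ∀ q : HeightOneSpectrum (𝓞 ℚ), Subgroup.zpowers (η q) = ⊤)
    (hPort : ∀ (k k' : ℕ) (Dk : KolyvaginDatum (W.torsionGaloisModule (((3 : ℕ) : ℤ) ^ k * ((3 : ℕ) : ℤ))))
      (Dk' : KolyvaginDatum (W.torsionGaloisModule (((3 : ℕ) : ℤ) ^ k' * ((3 : ℕ) : ℤ))))
      (red : (W.torsionGaloisModule (((3 : ℕ) : ℤ) ^ k' * ((3 : ℕ) : ℤ))).toContRepresentation →ⁱL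
        (W.torsionGaloisModule (((3 : ℕ) : ℤ) ^ k * ((3 : ℕ) : ℤ))).toContRepresentation),
      Dk.IsCanonicalTauDatumThreeAtWith W k k η → Dk'.IsCanonicalTauDatumThreeAtWith W k' k' η → k ≤ k' →
      (∀ x : geomTorsion W (((3 : ℕ) : ℤ) ^ k' * ((3 : ℕ) : ℤ)),
        ((red x : geomTorsion W (((3 : ℕ) : ℤ) ^ k * ((3 : ℕ) : ℤ))) : geomPoints W) =
          (((3 : ℕ) : ℤ) ^ (k' - k)) • (x : geomPoints W)) →
      ∃ κ Λ κ' κu Λu κu',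
        KatoKuriharaWitnessAtTwoExp W k 0 e Dk v₃ D κ Λ κ' ∧
        KatoKuriharaWitnessAtTwoExp W k' 0 e Dk' v₃ D κu Λu κu' ∧
        ∀ d, Dk'.IsLevel d → Dk.IsLevel d →
          galoisCohomology.map red 1 (κu d) = κ d ∧ galoisCohomology.map red 1 (κu' d) = κ' d)
    (hN : N = W.conductorNorm ℤ) :
    kuriharaPartialDeepInfty W 3 D.f ≤ kuriharaPartialInfty W 3 D.f :=
  shallowEqDeep_conclusion_of_upperRow_of_le_add_partialInfty W 3 D.f
    (upper_row_of_portUnlocked hS24 hS24₂ hGZK hPT W htower D e hint hord v₃ hv₃ η hη hPort)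
    (residual_row_of_portUnlocked hS24 hS24₂ hGZK hPT W htower D e hord v₃ hv₃ η hη hPort hN)

/-- **LOWER row (cruxes 19075 / 19679) at ANY tower row with the datum at the conductor:
`∃ d, ∂^{(∞)}_deep = d ∧ ∂⁽⁰⁾ ≤ ord₃ #Ш(3) + d`** from PUB + the unlocked port: (R) gives `a ≤ s + ∂ ≤ s + d`
(`kuriharaPartialInfty_le_kuriharaPartialDeepInfty`), `d` a natural number by the upper row.
[cite: Kim2022StructureSelmer, Thm. 1.9 (6), §1.5.1] [cite: MazurRubin2004, Def. 5.2.11, Thm. 5.2.12 (i)] -/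
theorem lower_row_of_portUnlocked
    (hS24 : Sakamoto2024.kolyvaginSystems_freeRankOne_zmod_three_pow)
    (hS24₂ : Sakamoto2024.kolyvaginSystems_idealOfBasis_eq_fittingIdeal_zmod_three_pow)
    (hGZK : rank_eq_analyticRank_of_analyticRank_le_one) (hPT : poitouTate_selmerStructure_duality ℚ)
    (W : WeierstrassCurve ℚ) [W.IsElliptic] [W.IsGloballyMinimal]
    (htower : ∀ m : ℕ, W.HasSurjectiveModNGaloisRep (3 ^ m : ℕ))
    {N : ℕ} [NeZero N] (D : ModularParametrizationData W N) (e : ℕ)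
    (hint : ∀ r : ℚ, ratPlusSymbol D.f r ≠ 0 → 0 ≤ padicValRat 3 (ratPlusSymbol D.f r))
    (hord : kuriharaVanishingOrder W 3 D.f = 0)
    (v₃ : HeightOneSpectrum (𝓞 ℚ)) (hv₃ : ((3 : ℕ) : 𝓞 ℚ) ∈ v₃.asIdeal)
    (η : (q : HeightOneSpectrum (𝓞 ℚ)) → (ZMod (Ideal.absNorm q.asIdeal))ˣ)
    (hη : ∀ q : HeightOneSpectrum (𝓞 ℚ), Subgroup.zpowers (η q) = ⊤)
    (hPort : ∀ (k k' : ℕ) (Dk : KolyvaginDatum (W.torsionGaloisModule (((3 : ℕ) : ℤ) ^ k * ((3 : ℕ) : ℤ))))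
      (Dk' : KolyvaginDatum (W.torsionGaloisModule (((3 : ℕ) : ℤ) ^ k' * ((3 : ℕ) : ℤ))))
      (red : (W.torsionGaloisModule (((3 : ℕ) : ℤ) ^ k' * ((3 : ℕ) : ℤ))).toContRepresentation →ⁱL
        (W.torsionGaloisModule (((3 : ℕ) : ℤ) ^ k * ((3 : ℕ) : ℤ))).toContRepresentation),
      Dk.IsCanonicalTauDatumThreeAtWith W k k η → Dk'.IsCanonicalTauDatumThreeAtWith W k' k' η → k ≤ k' →
      (∀ x : geomTorsion W (((3 : ℕ) : ℤ) ^ k' * ((3 : ℕ) : ℤ)),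
        ((red x : geomTorsion W (((3 : ℕ) : ℤ) ^ k * ((3 : ℕ) : ℤ))) : geomPoints W) =
          (((3 : ℕ) : ℤ) ^ (k' - k)) • (x : geomPoints W)) →
      ∃ κ Λ κ' κu Λu κu',
        KatoKuriharaWitnessAtTwoExp W k 0 e Dk v₃ D κ Λ κ' ∧
        KatoKuriharaWitnessAtTwoExp W k' 0 e Dk' v₃ D κu Λu κu' ∧
        ∀ d, Dk'.IsLevel d → Dk.IsLevel d →
          galoisCohomology.map red 1 (κu d) = κ d ∧ galoisCohomology.map red 1 (κu' d) = κ' d)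
    (hN : N = W.conductorNorm ℤ) :
    ∃ dd : ℕ, kuriharaPartialDeepInfty W 3 D.f = dd ∧
      kuriharaPartial W 3 D.f 0 ≤
        ((padicValNat 3 (Nat.card (AddCommGroup.primaryComponent W.sha 3)) + dd : ℕ) : ℕ∞) := by
  obtain ⟨d, hd, -⟩ := upper_row_of_portUnlocked hS24 hS24₂ hGZK hPT W htower D e hint hord v₃ hv₃ η hη hPort
  refine ⟨d, hd, (residual_row_of_portUnlocked hS24 hS24₂ hGZK hPT W htower D e hord v₃ hv₃ η hη hPort hN).trans
    ?_⟩
  rw [Nat.cast_add, ← hd]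
  exact add_le_add le_rfl (kuriharaPartialInfty_le_kuriharaPartialDeepInfty W 3 D.f)

/-- **The LEAF row (`N11.KimAtThreeRankZeroPUB` at the row = Kim's clause (6) at `p = 3`):
`∃ d, ∂^{(∞)} = d ∧ ∂⁽⁰⁾ = ord₃ #Ш(3) + d`** at ANY tower row with the datum at the conductor, from PUB + the
unlocked port (`s + d ≤ a ≤ s + ∂ ≤ s + d`). [cite: Kim2025RefinedTNC, Thm 1.1] [cite: Kim2022StructureSelmer, Thm. 1.9 (6)]
[cite: Sakamoto2024, Thm. 4.4 (p. 926)] [cite: MazurRubin2004, Thm. 4.4.1 and Thm. 5.2.12] -/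
theorem leaf_row_of_portUnlocked
    (hS24 : Sakamoto2024.kolyvaginSystems_freeRankOne_zmod_three_pow)
    (hS24₂ : Sakamoto2024.kolyvaginSystems_idealOfBasis_eq_fittingIdeal_zmod_three_pow)
    (hGZK : rank_eq_analyticRank_of_analyticRank_le_one) (hPT : poitouTate_selmerStructure_duality ℚ)
    (W : WeierstrassCurve ℚ) [W.IsElliptic] [W.IsGloballyMinimal]
    (htower : ∀ m : ℕ, W.HasSurjectiveModNGaloisRep (3 ^ m : ℕ))
    {N : ℕ} [NeZero N] (D : ModularParametrizationData W N) (e : ℕ)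
    (hint : ∀ r : ℚ, ratPlusSymbol D.f r ≠ 0 → 0 ≤ padicValRat 3 (ratPlusSymbol D.f r))
    (hord : kuriharaVanishingOrder W 3 D.f = 0)
    (v₃ : HeightOneSpectrum (𝓞 ℚ)) (hv₃ : ((3 : ℕ) : 𝓞 ℚ) ∈ v₃.asIdeal)
    (η : (q : HeightOneSpectrum (𝓞 ℚ)) → (ZMod (Ideal.absNorm q.asIdeal))ˣ)
    (hη : ∀ q : HeightOneSpectrum (𝓞 ℚ), Subgroup.zpowers (η q) = ⊤)
    (hPort : ∀ (k k' : ℕ) (Dk : KolyvaginDatum (W.torsionGaloisModule (((3 : ℕ) : ℤ) ^ k * ((3 : ℕ) : ℤ))))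
      (Dk' : KolyvaginDatum (W.torsionGaloisModule (((3 : ℕ) : ℤ) ^ k' * ((3 : ℕ) : ℤ))))
      (red : (W.torsionGaloisModule (((3 : ℕ) : ℤ) ^ k' * ((3 : ℕ) : ℤ))).toContRepresentation →ⁱL
        (W.torsionGaloisModule (((3 : ℕ) : ℤ) ^ k * ((3 : ℕ) : ℤ))).toContRepresentation),
      Dk.IsCanonicalTauDatumThreeAtWith W k k η → Dk'.IsCanonicalTauDatumThreeAtWith W k' k' η → k ≤ k' →
      (∀ x : geomTorsion W (((3 : ℕ) : ℤ) ^ k' * ((3 : ℕ) : ℤ)),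
        ((red x : geomTorsion W (((3 : ℕ) : ℤ) ^ k * ((3 : ℕ) : ℤ))) : geomPoints W) =
          (((3 : ℕ) : ℤ) ^ (k' - k)) • (x : geomPoints W)) →
      ∃ κ Λ κ' κu Λu κu',
        KatoKuriharaWitnessAtTwoExp W k 0 e Dk v₃ D κ Λ κ' ∧
        KatoKuriharaWitnessAtTwoExp W k' 0 e Dk' v₃ D κu Λu κu' ∧
        ∀ d, Dk'.IsLevel d → Dk.IsLevel d →
          galoisCohomology.map red 1 (κu d) = κ d ∧ galoisCohomology.map red 1 (κu' d) = κ' d)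
    (hN : N = W.conductorNorm ℤ) :
    ∃ dd : ℕ, kuriharaPartialInfty W 3 D.f = dd ∧
      kuriharaPartial W 3 D.f 0 =
        ((padicValNat 3 (Nat.card (AddCommGroup.primaryComponent W.sha 3)) + dd : ℕ) : ℕ∞) := by
  obtain ⟨d, hd, hge⟩ := upper_row_of_portUnlocked hS24 hS24₂ hGZK hPT W htower D e hint hord v₃ hv₃ η hη hPort
  have hle := residual_row_of_portUnlocked hS24 hS24₂ hGZK hPT W htower D e hord v₃ hv₃ η hη hPort hN
  set s := padicValNat 3 (Nat.card (AddCommGroup.primaryComponent W.sha 3)) with hs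
  -- `∂ ≤ d`, so `∂` is a natural number `j ≤ d`
  have hpd : kuriharaPartialInfty W 3 D.f ≤ (d : ℕ∞) := by
    rw [← hd]
    exact kuriharaPartialInfty_le_kuriharaPartialDeepInfty W 3 D.f
  have hptop : kuriharaPartialInfty W 3 D.f ≠ ⊤ := ne_top_of_le_ne_top (ENat.coe_ne_top d) hpd
  obtain ⟨j, hj⟩ : ∃ j : ℕ, kuriharaPartialInfty W 3 D.f = j :=
    (ENat.ne_top_iff_exists.mp hptop).imp fun j h => h.symm
  have hjd : j ≤ d := by
    rw [hj] at hpd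
    exact_mod_cast hpd
  -- `s + d ≤ a ≤ s + j`, so `d ≤ j`
  have hchain : ((s + d : ℕ) : ℕ∞) ≤ (s : ℕ∞) + (j : ℕ∞) := by
    rw [← hj]
    exact hge.trans hle
  have hdj : d ≤ j := by
    have : s + d ≤ s + j := by exact_mod_cast hchain
    omega
  have hjd' : j = d := le_antisymm hjd hdj
  refine ⟨d, ?_, le_antisymm ?_ hge⟩
  · rw [hj, hjd']
  · calc kuriharaPartial W 3 D.f 0 ≤ (s : ℕ∞) + kuriharaPartialInfty W 3 D.f := hle
      _ = ((s + d : ℕ) : ℕ∞) := by rw [hj, hjd', Nat.cast_add]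


end Summit.BirchSwinnertonDyer.BirchSwinnertonDyer.Theorems.KimAtThreeShallowEqDeepPortRows

end
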